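import Literature.NumberTheory.LFunctions.NicolasCChainCheck
import HarnessLib

/-!
# RH-FREE — `c(p#) ≥ 2.2088` for the primes `3 ≤ p ≤ 360649` by kernel computation: the certified run (Nicolas 2012, Thm. 1.1 (1.7)); nothing here bears on the truth of RH

RH-FREE (a kernel computation; nothing is asserted, no definition); nothing here bears on the truth
of RH. `run` evaluates `NicolasCChain.runDC 30800 NicolasCChain.initC` — `30800` steps of the
`c`-chain of `NicolasCChainCheck.lean` along the prime table `ChainTable.table`, each certifying the
primality of the next entry `p'`, extending the enclosures of `log p'`, `θ(p')` (two-sided) and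
`∏_{q ≤ p'} q/(q−1)`, and performing the comparison `cChk` that yields `c(p'#) ≥ 2.2088` — from the
prime `2` to the prime `360649 > 599² = 358801` (entry `30800` of `table.tail`, as in
`NicolasChainRun.lean`); only the prime reached is recorded in the statement. The meaning of the run is
supplied by `NicolasCChain.runDC_sound` (`NicolasCChainSound.lean`); the assembly with the analytic
range `p ≥ 599²` under RH (`NicolasCLimsupRH.lean`, §9) is `NicolasCTwoCriterion.lean`.
`decide +kernel`, standard axioms only (`maxHeartbeats 0` lifts the deterministic time-out).

## References

* J.-L. Nicolas, *Small values of the Euler function and the Riemann hypothesis*, Acta Arith. 155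
  (2012), 311–321, Thm. 1.1 (1.7), §4. [Nicolas2012]
-/

namespace Literature.NumberTheory.LFunctions.NicolasCChainRun

open NicolasCChain

set_option maxHeartbeats 0 in
/-- **The certified `c`-chain run** (steps `0` to `30800`, primes `2` to `360649`): every step
passes, and the prime reached is `360649`. [cite: Nicolas2012, Thm. 1.1 (1.7)] -/
theorem run : (runDC 30800 initC).map NCS.p = some 360649 := by
  decide +kernel

end Literature.NumberTheory.LFunctions.NicolasCChainRun
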